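import Summits.QuantumFields.YangMills.Theorems.PoincareLipschitzUniformSmallScaleEnergyOfZeroDensity
import Summits.QuantumFields.YangMills.Theorems.PoincareLipschitzMinimiserMonotonicity
import Summits.QuantumFields.YangMills.Theorems.PoincareLipschitzMinimiserDilation
import Summits.QuantumFields.YangMills.Theorems.PoincareLipschitzMonotonicityEquality
import Mathlib.MeasureTheory.Measure.Lebesgue.EqHaar
import HarnessLib

/-!
# Crux `BlockLipschitzL` (stmt-QuantumFields-23533) ∕ `HistoryTailL` (stmt-QuantumFields-19936), LINE 25 «CompactnessTransfer»,
# stub S1″ — the (TM) re-cut, file TM-D «ZERO DENSITY FROM COMPACTNESS AND THE TANGENT-MAP PROPOSITION» (THE KNIT)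

Cell `ym3-torus` (YM ladder rung R3 = continuum SU(2) Yang–Mills on T³ — a RUNG, NOT Clay: not d = 4, not infinite volume,
not a mass gap); WIDTH helper seat `ym3-torus-px3` g9 (LEAD ★w1-19936 g10 «GO (TM)» 14:49:45Z, ★w3 g15 GO 14:50:23Z);
`--supports stmt-QuantumFields-23533`; THEOREMS ONLY (0 `def`, 0 `sorry`, default heartbeats); imports TM-A ✓`…OfZeroDensity`,
★w3's ✓`…MinimiserMonotonicity` (`hMono_holds`), TM-B2 ✓`…MinimiserDilation`, TM-C2 ✓`…MonotonicityEquality`, Mathlib `EqHaar`.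

WHAT THIS FILE DOES.  The blow-up argument [Simon1996, §3.1–§3.2] in the tree's Sobolev vocabulary, for the vended class of
LINE 25 ∕ lit `HarmonicMapMinimisers` (finite-energy unit `W^{1,2}` maps `U : Q → S³ ⊂ ℝ⁴` minimising the Dirichlet energy on
every ball `B̄_ρ(y) ⊆ Q` against finite-energy unit competitors agreeing with `U` off a smaller concentric ball):
* ★★★ `zeroDensity_of_rows (hMono) (hCpt) (hTM) : ⟨(ZD)⟩` — every class member has ZERO DENSITY AT THE CENTRE, from the rows
  (M) monotonicity, (C) compactness (the rows of ✓`…OfRows` VERBATIM) and **(TM)** «a class member with `G x (x) = 0` a.e. on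
  `Q` has `G = 0` a.e. on `Q`» — i.e. a RADIALLY CONSTANT ball-minimiser into `S³` is constant.  Read through (DIL) (TM-B2), a
  radially constant class member is the restriction to `Q` of a degree-zero homogeneous local minimiser `ℝ³ → S³` (every ball of
  `ℝ³` dilates into `Q`, the map is dilation-fixed, minimality transports by ✓`setIntegral_dens_dilate_ball`), that is, of a
  MINIMIZING TANGENT MAP; so (TM) is [SchoenUhlenbeck1984, Prop. 1.2 p. 90] «a minimizing tangent map `ℝ³ → S³` is constant»
  (`n = 3 ≤ d(3) = 3`), stated on the cube.  PROOF: `Θ := inf_{0<r≤1∕2} r⁻¹E(U;B_r(0))` (= `lim_{r↓0}`, by (M)); the dilations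
  `U_j := U ∘ (t_j•)`, `t_j = 4⁻¹2⁻ʲ`, are class members (TM-B2 ★★★`sMin_dilate`) with `E(U_j; Q) ≤ 2√3·E(U; B_{1∕2})` ((M) +
  `Q_t ⊆ B_{√3t}`); (C) gives a class member `φ` with `E(φ; B_r(0)) = lim_j E(U_{ψj}; B_r(0)) = lim_j r·(t_{ψj}r)⁻¹E(U; B_{t_{ψj}r}) = Θ·r`
  for `0 < r ≤ 1∕2`; TM-C2 ★★★`radialDeriv_ae_zero_of_ball_linear` ⇒ `G_φ x (x) = 0` a.e. on `B_{1∕4}(0)`; the dilation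
  `φ_{1∕8}` is a class member, radially constant a.e. on `Q` (`Q∕8 ⊆ B_{1∕4}`; Lebesgue null sets dilate to null sets), so (TM)
  gives `G_{φ_{1∕8}} = 0` a.e., whence `Θ∕2 = E(φ_{1∕8}; B_{1∕2}) = 0`; `Θ = 0` is (ZD).  **NO ε-regularity anywhere.**
* The two-row forms — ★★★`zeroDensity_of_compactness_tangentMaps (hCpt) (hTM)` ((M) := ✓`hMono_holds`) and the S1″ knit
  ★★★`uniformSmallScaleEnergy_band_of_compactness_tangentMaps (hCpt) (hTM)` — are file TM-E ✓`…UniformSmallScaleEnergyOfTangentMaps`.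
ON DISCHARGING (TM) (honest note, LEAD 14:49:45Z): w7 g14's stability inequality (RS-a) `∫ζ²·dens ≤ 3∫‖∇ζ‖²` + Hardy's
inequality (lit ✓`HardyEulerWeightedPlain`, constant `¼`) cap the density of every minimizing tangent map by `E_{S²}(ω) ≤ 3π`,
elementarily; the last step «`0 < E_{S²}(ω) < 8π` is impossible» is the energy gap for WEAKLY harmonic 2-spheres in `S³`, whose
printed proofs pass through Hélein's regularity of weakly harmonic maps of surfaces (or [SchoenUhlenbeck1982] away from the
origin) — so (TM) is budgeted as a NAMED PRINTED FACT (★w3 g15 vends `MinimisingTangentMapConstant` in lit `HarmonicMapMinimisers`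
with the (TM) text below, token for token), replacing [SchoenUhlenbeck1984, Thm. 2.7] (full interior regularity) on the K2 face.
HONEST SCOPE.  (C) and (TM) are HYPOTHESES (printed theorems); (ZD), S1″ are NOT proved unconditionally; S2♭″, K1, `MeanDeviationL`,
`BlockLipschitzL`, `HistoryTailL` NOT proved.  YM₃ on T³ is rung R3, not Clay; YM gap NOT proved; no summit statement is proved here.

References: L. Simon, Theorems on Regularity and Singularity of Energy Minimizing Maps (1996) [Simon1996] (§2.4, §2.9 Lemma 1,
§3.1–§3.2 tangent maps, densities, homogeneity); R. Schoen, K. Uhlenbeck, Invent. Math. 78 (1984) 89–100 [SchoenUhlenbeck1984]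
(Prop. 1.2 p. 90; Thm. 2.7 p. 96; `d(3) = 3` p. 89); J. Differential Geom. 17 (1982) [SchoenUhlenbeck1982] (§2 scaling);
S. Luckhaus, Indiana Univ. Math. J. 37 (1988) [Luckhaus1988].
-/

set_option autoImplicit false

noncomputable section

open scoped BigOperators Topology
open MeasureTheory Set Filter Metric Function TopologicalSpace

namespace Summit.QuantumFields.YangMills.Theorems.PoincareLipschitzZeroDensityOfTangentMaps

open Literature.Analysis.FunctionSpaces (HasWeakFDerivOn)
open Summit.QuantumFields.YangMills.Theorems.PoincareLipschitzMinimiserBallBridge (absCube_subset_ball closedBall_subset_unitCube)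
open Summit.QuantumFields.YangMills.Theorems.PoincareLipschitzMinimiserMonotonicity (hMono_holds)
open Summit.QuantumFields.YangMills.Theorems.PoincareLipschitzMinimiserDilationLetters (setIntegral_dens_dilate_ball smul_mem_unitCube)
open Summit.QuantumFields.YangMills.Theorems.PoincareLipschitzMinimiserDilation (sMin_dilate setIntegral_dens_dilate_unitCube)
open Summit.QuantumFields.YangMills.Theorems.PoincareLipschitzMonotonicityEquality (radialDeriv_ae_zero_of_ball_linear)
open Summit.QuantumFields.YangMills.Theorems.PoincareLipschitzUniformSmallScaleEnergyOfZeroDensity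
  (uniformSmallScaleEnergy_band_of_zeroDensity)

/-! ## §1 Two letters: the radial sum is `G x (x)`; a.e. statements dilate -/

/-- `Σᵢ vᵢ • A eᵢ = A v` on `ℝ³`. [folklore] -/
theorem sum_smul_apply_single (A : EuclideanSpace ℝ (Fin 3) →L[ℝ] EuclideanSpace ℝ (Fin 4)) (v : EuclideanSpace ℝ (Fin 3)) :
    ∑ i : Fin 3, v i • A (EuclideanSpace.single i (1:ℝ)) = A v := by
  classical
  have h : ∑ i : Fin 3, v i • EuclideanSpace.single i (1:ℝ) = v := by
    have := (EuclideanSpace.basisFun (Fin 3) ℝ).sum_repr v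
    simpa only [EuclideanSpace.basisFun_apply, EuclideanSpace.basisFun_repr] using this
  conv_rhs => rw [← h]
  rw [map_sum]
  exact Finset.sum_congr rfl fun i _ => by rw [map_smul]

/-- A.e. statements on a ball transport to the cube under a dilation `x ↦ t•x` mapping the cube into the ball (Lebesgue null sets
have null preimages under dilations, `Measure.addHaar_preimage_smul`). [folklore] -/
theorem ae_restrict_unitCube_of_ae_restrict_ball {P : EuclideanSpace ℝ (Fin 3) → Prop} {t a : ℝ} (ht : 0 < t)
    (hta : ∀ x : EuclideanSpace ℝ (Fin 3), (∀ i : Fin 3, |x i| < 1) → t • x ∈ ball (0 : EuclideanSpace ℝ (Fin 3)) a)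
    (h : ∀ᵐ z ∂(volume.restrict (ball (0 : EuclideanSpace ℝ (Fin 3)) a)), P z) :
    ∀ᵐ x ∂(volume.restrict {x : EuclideanSpace ℝ (Fin 3) | ∀ i : Fin 3, |x i| < 1}), P (t • x) := by
  have hQ : IsOpen {x : EuclideanSpace ℝ (Fin 3) | ∀ i : Fin 3, |x i| < 1} := Summit.QuantumFields.YangMills.Theorems.PoincareLipschitzSamplingCells.isOpen_absCube 1
  have h1 : ∀ᵐ z ∂(volume : Measure (EuclideanSpace ℝ (Fin 3))), z ∈ ball (0 : EuclideanSpace ℝ (Fin 3)) a → P z :=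
    (ae_restrict_iff' measurableSet_ball).1 h
  have hN : volume {z : EuclideanSpace ℝ (Fin 3) | ¬ (z ∈ ball (0 : EuclideanSpace ℝ (Fin 3)) a → P z)} = 0 := ae_iff.1 h1
  have hN' : volume ((fun x : EuclideanSpace ℝ (Fin 3) => t • x) ⁻¹'
      {z : EuclideanSpace ℝ (Fin 3) | ¬ (z ∈ ball (0 : EuclideanSpace ℝ (Fin 3)) a → P z)}) = 0 := by
    rw [Measure.addHaar_preimage_smul volume ht.ne', hN, mul_zero]
  refine (ae_restrict_iff' hQ.measurableSet).2 (ae_iff.2 (measure_mono_null (fun x hx => ?_) hN'))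
  simp only [mem_setOf_eq, mem_preimage] at hx ⊢
  intro himp
  exact hx fun hxQ => himp (hta x hxQ)

/-! ## §2 (ZD) from (M), (C), (TM) by blow-up -/

-- hb: measured 2026-08-29 px3 g9 — PASS at the farm default (200k), FAIL at 100k (`whnf` on the 40-line (M)/(C) row binders +
-- the blow-up bookkeeping in one declaration); decl-local budget per README «HEARTBEAT BUDGET» / №24 (a), statement untouched.
set_option maxHeartbeats 400000 in
/-- ★★★ **ZERO DENSITY AT THE CENTRE FROM (M), (C) AND THE TANGENT-MAP PROPOSITION (TM).**  Rows as binder texts: (M) monotonicity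
and (C) compactness VERBATIM from ✓`…OfRows`; (TM) «a class member with vanishing radial derivative `G x (x) = 0` a.e. on `Q` is
constant (`G = 0` a.e. on `Q`)» = [SchoenUhlenbeck1984, Prop. 1.2] read on the cube through (DIL).  Conclusion: the (ZD) row of
TM-A.  Proof: blow-up at the centre (TM-B2 dilations + (C)), monotonicity equality (TM-C2), one more dilation, (TM). [cite: Simon1996, §3.1–§3.2 and §2.4; SchoenUhlenbeck1984, Prop. 1.2 (p. 90); SchoenUhlenbeck1982, §2] -/
theorem zeroDensity_of_rows
    (hMono : ∀ (hQ : IsOpen {x : EuclideanSpace ℝ (Fin 3) | ∀ i : Fin 3, |x i| < 1}) (U : EuclideanSpace ℝ (Fin 3) → EuclideanSpace ℝ (Fin 4)) (G : EuclideanSpace ℝ (Fin 3) → (EuclideanSpace ℝ (Fin 3) →L[ℝ] EuclideanSpace ℝ (Fin 4))),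
      (HasWeakFDerivOn ⟨{x : EuclideanSpace ℝ (Fin 3) | ∀ i : Fin 3, |x i| < 1}, hQ⟩ volume U G ∧
        (∀ x : EuclideanSpace ℝ (Fin 3), (∀ i : Fin 3, |x i| < 1) → ‖U x‖ = 1) ∧
        IntegrableOn (fun x => ∑ i : Fin 3, ‖G x (EuclideanSpace.single i (1:ℝ))‖ ^ 2) {x : EuclideanSpace ℝ (Fin 3) | ∀ i : Fin 3, |x i| < 1} ∧
        (∀ (y : EuclideanSpace ℝ (Fin 3)) (ρ : ℝ), 0 < ρ → closedBall y ρ ⊆ {x : EuclideanSpace ℝ (Fin 3) | ∀ i : Fin 3, |x i| < 1} →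
          ∀ (W : EuclideanSpace ℝ (Fin 3) → EuclideanSpace ℝ (Fin 4)) (GW : EuclideanSpace ℝ (Fin 3) → (EuclideanSpace ℝ (Fin 3) →L[ℝ] EuclideanSpace ℝ (Fin 4))),
          HasWeakFDerivOn ⟨{x : EuclideanSpace ℝ (Fin 3) | ∀ i : Fin 3, |x i| < 1}, hQ⟩ volume W GW →
          (∀ x : EuclideanSpace ℝ (Fin 3), (∀ i : Fin 3, |x i| < 1) → ‖W x‖ = 1) →
          IntegrableOn (fun x => ∑ i : Fin 3, ‖GW x (EuclideanSpace.single i (1:ℝ))‖ ^ 2) {x : EuclideanSpace ℝ (Fin 3) | ∀ i : Fin 3, |x i| < 1} →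
          (∃ ρ' : ℝ, ρ' < ρ ∧ ∀ x : EuclideanSpace ℝ (Fin 3), x ∉ ball y ρ' → W x = U x) →
          ∫ x in ball y ρ, ∑ i : Fin 3, ‖G x (EuclideanSpace.single i (1:ℝ))‖ ^ 2 ≤ ∫ x in ball y ρ, ∑ i : Fin 3, ‖GW x (EuclideanSpace.single i (1:ℝ))‖ ^ 2)) →
      ∀ (y : EuclideanSpace ℝ (Fin 3)) (σ ρ : ℝ), 0 < σ → σ ≤ ρ → closedBall y ρ ⊆ {x : EuclideanSpace ℝ (Fin 3) | ∀ i : Fin 3, |x i| < 1} →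
        σ⁻¹ * ∫ x in ball y σ, ∑ i : Fin 3, ‖G x (EuclideanSpace.single i (1:ℝ))‖ ^ 2 ≤ ρ⁻¹ * ∫ x in ball y ρ, ∑ i : Fin 3, ‖G x (EuclideanSpace.single i (1:ℝ))‖ ^ 2)
    (hCpt : ∀ (hQ : IsOpen {x : EuclideanSpace ℝ (Fin 3) | ∀ i : Fin 3, |x i| < 1}) (Λ : ℝ) (u : ℕ → EuclideanSpace ℝ (Fin 3) → EuclideanSpace ℝ (Fin 4)) (Gs : ℕ → EuclideanSpace ℝ (Fin 3) → (EuclideanSpace ℝ (Fin 3) →L[ℝ] EuclideanSpace ℝ (Fin 4))),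
      (∀ j : ℕ, (HasWeakFDerivOn ⟨{x : EuclideanSpace ℝ (Fin 3) | ∀ i : Fin 3, |x i| < 1}, hQ⟩ volume (u j) (Gs j) ∧
        (∀ x : EuclideanSpace ℝ (Fin 3), (∀ i : Fin 3, |x i| < 1) → ‖(u j) x‖ = 1) ∧
        IntegrableOn (fun x => ∑ i : Fin 3, ‖(Gs j) x (EuclideanSpace.single i (1:ℝ))‖ ^ 2) {x : EuclideanSpace ℝ (Fin 3) | ∀ i : Fin 3, |x i| < 1} ∧
        (∀ (y : EuclideanSpace ℝ (Fin 3)) (ρ : ℝ), 0 < ρ → closedBall y ρ ⊆ {x : EuclideanSpace ℝ (Fin 3) | ∀ i : Fin 3, |x i| < 1} →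
          ∀ (W : EuclideanSpace ℝ (Fin 3) → EuclideanSpace ℝ (Fin 4)) (GW : EuclideanSpace ℝ (Fin 3) → (EuclideanSpace ℝ (Fin 3) →L[ℝ] EuclideanSpace ℝ (Fin 4))),
          HasWeakFDerivOn ⟨{x : EuclideanSpace ℝ (Fin 3) | ∀ i : Fin 3, |x i| < 1}, hQ⟩ volume W GW →
          (∀ x : EuclideanSpace ℝ (Fin 3), (∀ i : Fin 3, |x i| < 1) → ‖W x‖ = 1) →
          IntegrableOn (fun x => ∑ i : Fin 3, ‖GW x (EuclideanSpace.single i (1:ℝ))‖ ^ 2) {x : EuclideanSpace ℝ (Fin 3) | ∀ i : Fin 3, |x i| < 1} →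
          (∃ ρ' : ℝ, ρ' < ρ ∧ ∀ x : EuclideanSpace ℝ (Fin 3), x ∉ ball y ρ' → W x = (u j) x) →
          ∫ x in ball y ρ, ∑ i : Fin 3, ‖(Gs j) x (EuclideanSpace.single i (1:ℝ))‖ ^ 2 ≤ ∫ x in ball y ρ, ∑ i : Fin 3, ‖GW x (EuclideanSpace.single i (1:ℝ))‖ ^ 2))) →
      (∀ j : ℕ, ∫ x in {x : EuclideanSpace ℝ (Fin 3) | ∀ i : Fin 3, |x i| < 1}, ∑ i : Fin 3, ‖(Gs j) x (EuclideanSpace.single i (1:ℝ))‖ ^ 2 ≤ Λ) →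
      ∃ (U : EuclideanSpace ℝ (Fin 3) → EuclideanSpace ℝ (Fin 4)) (G : EuclideanSpace ℝ (Fin 3) → (EuclideanSpace ℝ (Fin 3) →L[ℝ] EuclideanSpace ℝ (Fin 4))) (φ : ℕ → ℕ), StrictMono φ ∧
        (HasWeakFDerivOn ⟨{x : EuclideanSpace ℝ (Fin 3) | ∀ i : Fin 3, |x i| < 1}, hQ⟩ volume U G ∧
          (∀ x : EuclideanSpace ℝ (Fin 3), (∀ i : Fin 3, |x i| < 1) → ‖U x‖ = 1) ∧
          IntegrableOn (fun x => ∑ i : Fin 3, ‖G x (EuclideanSpace.single i (1:ℝ))‖ ^ 2) {x : EuclideanSpace ℝ (Fin 3) | ∀ i : Fin 3, |x i| < 1} ∧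
          (∀ (y : EuclideanSpace ℝ (Fin 3)) (ρ : ℝ), 0 < ρ → closedBall y ρ ⊆ {x : EuclideanSpace ℝ (Fin 3) | ∀ i : Fin 3, |x i| < 1} →
            ∀ (W : EuclideanSpace ℝ (Fin 3) → EuclideanSpace ℝ (Fin 4)) (GW : EuclideanSpace ℝ (Fin 3) → (EuclideanSpace ℝ (Fin 3) →L[ℝ] EuclideanSpace ℝ (Fin 4))),
            HasWeakFDerivOn ⟨{x : EuclideanSpace ℝ (Fin 3) | ∀ i : Fin 3, |x i| < 1}, hQ⟩ volume W GW →
            (∀ x : EuclideanSpace ℝ (Fin 3), (∀ i : Fin 3, |x i| < 1) → ‖W x‖ = 1) →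
            IntegrableOn (fun x => ∑ i : Fin 3, ‖GW x (EuclideanSpace.single i (1:ℝ))‖ ^ 2) {x : EuclideanSpace ℝ (Fin 3) | ∀ i : Fin 3, |x i| < 1} →
            (∃ ρ' : ℝ, ρ' < ρ ∧ ∀ x : EuclideanSpace ℝ (Fin 3), x ∉ ball y ρ' → W x = U x) →
            ∫ x in ball y ρ, ∑ i : Fin 3, ‖G x (EuclideanSpace.single i (1:ℝ))‖ ^ 2 ≤ ∫ x in ball y ρ, ∑ i : Fin 3, ‖GW x (EuclideanSpace.single i (1:ℝ))‖ ^ 2)) ∧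
        (∀ (y : EuclideanSpace ℝ (Fin 3)) (ρ : ℝ), 0 < ρ → closedBall y ρ ⊆ {x : EuclideanSpace ℝ (Fin 3) | ∀ i : Fin 3, |x i| < 1} →
          Tendsto (fun j : ℕ => ∫ x in ball y ρ, ‖u (φ j) x - U x‖ ^ 2) atTop (𝓝 0)) ∧
        (∀ (y : EuclideanSpace ℝ (Fin 3)) (ρ : ℝ), 0 < ρ → closedBall y ρ ⊆ {x : EuclideanSpace ℝ (Fin 3) | ∀ i : Fin 3, |x i| < 1} →
          Tendsto (fun j : ℕ => ∫ x in ball y ρ, ∑ i : Fin 3, ‖(Gs (φ j)) x (EuclideanSpace.single i (1:ℝ))‖ ^ 2) atTop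
            (𝓝 (∫ x in ball y ρ, ∑ i : Fin 3, ‖G x (EuclideanSpace.single i (1:ℝ))‖ ^ 2))))
    (hTM : ∀ (hQ : IsOpen {x : EuclideanSpace ℝ (Fin 3) | ∀ i : Fin 3, |x i| < 1}) (U : EuclideanSpace ℝ (Fin 3) → EuclideanSpace ℝ (Fin 4)) (G : EuclideanSpace ℝ (Fin 3) → (EuclideanSpace ℝ (Fin 3) →L[ℝ] EuclideanSpace ℝ (Fin 4))),
      (HasWeakFDerivOn ⟨{x : EuclideanSpace ℝ (Fin 3) | ∀ i : Fin 3, |x i| < 1}, hQ⟩ volume U G ∧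
        (∀ x : EuclideanSpace ℝ (Fin 3), (∀ i : Fin 3, |x i| < 1) → ‖U x‖ = 1) ∧
        IntegrableOn (fun x => ∑ i : Fin 3, ‖G x (EuclideanSpace.single i (1:ℝ))‖ ^ 2) {x : EuclideanSpace ℝ (Fin 3) | ∀ i : Fin 3, |x i| < 1} ∧
        (∀ (y : EuclideanSpace ℝ (Fin 3)) (ρ : ℝ), 0 < ρ → closedBall y ρ ⊆ {x : EuclideanSpace ℝ (Fin 3) | ∀ i : Fin 3, |x i| < 1} →
          ∀ (W : EuclideanSpace ℝ (Fin 3) → EuclideanSpace ℝ (Fin 4)) (GW : EuclideanSpace ℝ (Fin 3) → (EuclideanSpace ℝ (Fin 3) →L[ℝ] EuclideanSpace ℝ (Fin 4))),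
          HasWeakFDerivOn ⟨{x : EuclideanSpace ℝ (Fin 3) | ∀ i : Fin 3, |x i| < 1}, hQ⟩ volume W GW →
          (∀ x : EuclideanSpace ℝ (Fin 3), (∀ i : Fin 3, |x i| < 1) → ‖W x‖ = 1) →
          IntegrableOn (fun x => ∑ i : Fin 3, ‖GW x (EuclideanSpace.single i (1:ℝ))‖ ^ 2) {x : EuclideanSpace ℝ (Fin 3) | ∀ i : Fin 3, |x i| < 1} →
          (∃ ρ' : ℝ, ρ' < ρ ∧ ∀ x : EuclideanSpace ℝ (Fin 3), x ∉ ball y ρ' → W x = U x) →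
          ∫ x in ball y ρ, ∑ i : Fin 3, ‖G x (EuclideanSpace.single i (1:ℝ))‖ ^ 2 ≤ ∫ x in ball y ρ, ∑ i : Fin 3, ‖GW x (EuclideanSpace.single i (1:ℝ))‖ ^ 2)) →
      (∀ᵐ x ∂(volume.restrict {x : EuclideanSpace ℝ (Fin 3) | ∀ i : Fin 3, |x i| < 1}), G x x = 0) →
      ∀ᵐ x ∂(volume.restrict {x : EuclideanSpace ℝ (Fin 3) | ∀ i : Fin 3, |x i| < 1}), G x = 0) :
    ∀ (hQ : IsOpen {x : EuclideanSpace ℝ (Fin 3) | ∀ i : Fin 3, |x i| < 1}) (U : EuclideanSpace ℝ (Fin 3) → EuclideanSpace ℝ (Fin 4)) (G : EuclideanSpace ℝ (Fin 3) → (EuclideanSpace ℝ (Fin 3) →L[ℝ] EuclideanSpace ℝ (Fin 4))),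
      (HasWeakFDerivOn ⟨{x : EuclideanSpace ℝ (Fin 3) | ∀ i : Fin 3, |x i| < 1}, hQ⟩ volume U G ∧
        (∀ x : EuclideanSpace ℝ (Fin 3), (∀ i : Fin 3, |x i| < 1) → ‖U x‖ = 1) ∧
        IntegrableOn (fun x => ∑ i : Fin 3, ‖G x (EuclideanSpace.single i (1:ℝ))‖ ^ 2) {x : EuclideanSpace ℝ (Fin 3) | ∀ i : Fin 3, |x i| < 1} ∧
        (∀ (y : EuclideanSpace ℝ (Fin 3)) (ρ : ℝ), 0 < ρ → closedBall y ρ ⊆ {x : EuclideanSpace ℝ (Fin 3) | ∀ i : Fin 3, |x i| < 1} →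
          ∀ (W : EuclideanSpace ℝ (Fin 3) → EuclideanSpace ℝ (Fin 4)) (GW : EuclideanSpace ℝ (Fin 3) → (EuclideanSpace ℝ (Fin 3) →L[ℝ] EuclideanSpace ℝ (Fin 4))),
          HasWeakFDerivOn ⟨{x : EuclideanSpace ℝ (Fin 3) | ∀ i : Fin 3, |x i| < 1}, hQ⟩ volume W GW →
          (∀ x : EuclideanSpace ℝ (Fin 3), (∀ i : Fin 3, |x i| < 1) → ‖W x‖ = 1) →
          IntegrableOn (fun x => ∑ i : Fin 3, ‖GW x (EuclideanSpace.single i (1:ℝ))‖ ^ 2) {x : EuclideanSpace ℝ (Fin 3) | ∀ i : Fin 3, |x i| < 1} →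
          (∃ ρ' : ℝ, ρ' < ρ ∧ ∀ x : EuclideanSpace ℝ (Fin 3), x ∉ ball y ρ' → W x = U x) →
          ∫ x in ball y ρ, ∑ i : Fin 3, ‖G x (EuclideanSpace.single i (1:ℝ))‖ ^ 2 ≤ ∫ x in ball y ρ, ∑ i : Fin 3, ‖GW x (EuclideanSpace.single i (1:ℝ))‖ ^ 2)) →
      ∀ η : ℝ, 0 < η → ∃ ρ : ℝ, 0 < ρ ∧ ρ < 1 ∧
        ρ⁻¹ * ∫ x in ball (0 : EuclideanSpace ℝ (Fin 3)) ρ, ∑ i : Fin 3, ‖G x (EuclideanSpace.single i (1:ℝ))‖ ^ 2 ≤ η := by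
  intro hQ U G hS η hη
  have hS' := hS
  obtain ⟨hU, hU1, hGi, hmin⟩ := hS'
  -- notation-free shorthands
  have hdens0 : ∀ (G' : EuclideanSpace ℝ (Fin 3) → (EuclideanSpace ℝ (Fin 3) →L[ℝ] EuclideanSpace ℝ (Fin 4))) (x : EuclideanSpace ℝ (Fin 3)), 0 ≤ ∑ i : Fin 3, ‖G' x (EuclideanSpace.single i (1:ℝ))‖ ^ 2 :=
    fun G' x => Finset.sum_nonneg fun i _ => by positivity
  have hE0 : ∀ r : ℝ, 0 ≤ ∫ x in ball (0 : EuclideanSpace ℝ (Fin 3)) r, ∑ i : Fin 3, ‖G x (EuclideanSpace.single i (1:ℝ))‖ ^ 2 :=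
    fun r => setIntegral_nonneg measurableSet_ball fun x _ => hdens0 G x
  have hcB : ∀ r : ℝ, r < 1 → closedBall (0 : EuclideanSpace ℝ (Fin 3)) r ⊆ {x : EuclideanSpace ℝ (Fin 3) | ∀ i : Fin 3, |x i| < 1} := fun r hr => closedBall_subset_unitCube hr
  -- the density ratio `f r := r⁻¹ E(B_r(0))` is monotone on `(0, 1/2]`
  have hmono : ∀ σ ρ : ℝ, 0 < σ → σ ≤ ρ → ρ ≤ 1 / 2 →
      σ⁻¹ * ∫ x in ball (0 : EuclideanSpace ℝ (Fin 3)) σ, ∑ i : Fin 3, ‖G x (EuclideanSpace.single i (1:ℝ))‖ ^ 2 ≤ ρ⁻¹ * ∫ x in ball (0 : EuclideanSpace ℝ (Fin 3)) ρ, ∑ i : Fin 3, ‖G x (EuclideanSpace.single i (1:ℝ))‖ ^ 2 :=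
    fun σ ρ hσ hσρ hρ => hMono hQ U G hS 0 σ ρ hσ hσρ (hcB ρ (by linarith))
  -- `Θ := inf` of the density ratio over `(0, 1/2]`
  set S : Set ℝ := (fun r : ℝ => r⁻¹ * ∫ x in ball (0 : EuclideanSpace ℝ (Fin 3)) r, ∑ i : Fin 3, ‖G x (EuclideanSpace.single i (1:ℝ))‖ ^ 2) '' Ioc (0:ℝ) (1 / 2) with hS_def
  have hSne : S.Nonempty := ⟨_, ⟨1 / 2, ⟨by norm_num, le_rfl⟩, rfl⟩⟩
  have hSbdd : BddBelow S := ⟨0, by rintro _ ⟨r, hr, rfl⟩; exact mul_nonneg (inv_nonneg.2 hr.1.le) (hE0 r)⟩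
  set Θ : ℝ := sInf S with hΘ_def
  have hΘle : ∀ r : ℝ, 0 < r → r ≤ 1 / 2 → Θ ≤ r⁻¹ * ∫ x in ball (0 : EuclideanSpace ℝ (Fin 3)) r, ∑ i : Fin 3, ‖G x (EuclideanSpace.single i (1:ℝ))‖ ^ 2 :=
    fun r hr hr2 => csInf_le hSbdd ⟨r, ⟨hr, hr2⟩, rfl⟩
  have hΘ0 : 0 ≤ Θ := le_csInf hSne (by rintro _ ⟨r, hr, rfl⟩; exact mul_nonneg (inv_nonneg.2 hr.1.le) (hE0 r))
  have hΘapprox : ∀ ε : ℝ, 0 < ε → ∃ r₀ : ℝ, 0 < r₀ ∧ r₀ ≤ 1 / 2 ∧ ∀ r : ℝ, 0 < r → r ≤ r₀ →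
      r⁻¹ * ∫ x in ball (0 : EuclideanSpace ℝ (Fin 3)) r, ∑ i : Fin 3, ‖G x (EuclideanSpace.single i (1:ℝ))‖ ^ 2 < Θ + ε := by
    intro ε hε
    obtain ⟨_, ⟨r₀, hr₀, rfl⟩, hlt⟩ := exists_lt_of_csInf_lt hSne (show sInf S < Θ + ε by linarith)
    exact ⟨r₀, hr₀.1, hr₀.2, fun r hr hrr₀ => (hmono r r₀ hr hrr₀ hr₀.2).trans_lt hlt⟩
  -- it suffices to show `Θ = 0`
  suffices hΘzero : Θ = 0 by
    obtain ⟨r₀, hr₀, hr₀2, hr₀lt⟩ := hΘapprox η hη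
    exact ⟨r₀, hr₀, by linarith, by have := hr₀lt r₀ hr₀ le_rfl; rw [hΘzero, zero_add] at this; exact this.le⟩
  -- the blow-up sequence `U_j = U ∘ (t_j•)`, `t_j = 4⁻¹·2⁻ʲ`
  set t : ℕ → ℝ := fun j => 4⁻¹ * (2⁻¹) ^ j with ht_def
  have ht0 : ∀ j, 0 < t j := fun j => by positivity
  have ht4 : ∀ j, t j ≤ 4⁻¹ := fun j => by
    have : (2⁻¹ : ℝ) ^ j ≤ 1 := pow_le_one₀ (by norm_num) (by norm_num)
    have := mul_le_mul_of_nonneg_left this (by norm_num : (0:ℝ) ≤ 4⁻¹); simpa [ht_def] using this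
  have ht1 : ∀ j, t j ≤ 1 := fun j => (ht4 j).trans (by norm_num)
  have htmono : ∀ j k, j ≤ k → t k ≤ t j := fun j k hjk =>
    mul_le_mul_of_nonneg_left (pow_le_pow_of_le_one (by norm_num) (by norm_num) hjk) (by norm_num)
  have htlim : Tendsto t atTop (𝓝 0) := by
    have := (tendsto_pow_atTop_nhds_zero_of_lt_one (by norm_num : (0:ℝ) ≤ 2⁻¹) (by norm_num)).const_mul (4⁻¹ : ℝ)
    simpa [ht_def] using this
  set u : ℕ → EuclideanSpace ℝ (Fin 3) → EuclideanSpace ℝ (Fin 4) := fun j x => U (t j • x) with hu_def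
  set Gs : ℕ → EuclideanSpace ℝ (Fin 3) → (EuclideanSpace ℝ (Fin 3) →L[ℝ] EuclideanSpace ℝ (Fin 4)) := fun j x => t j • G (t j • x) with hGs_def
  have hSMin : ∀ j : ℕ,
      (HasWeakFDerivOn ⟨{x : EuclideanSpace ℝ (Fin 3) | ∀ i : Fin 3, |x i| < 1}, hQ⟩ volume (u j) (Gs j) ∧
        (∀ x : EuclideanSpace ℝ (Fin 3), (∀ i : Fin 3, |x i| < 1) → ‖(u j) x‖ = 1) ∧
        IntegrableOn (fun x => ∑ i : Fin 3, ‖(Gs j) x (EuclideanSpace.single i (1:ℝ))‖ ^ 2) {x : EuclideanSpace ℝ (Fin 3) | ∀ i : Fin 3, |x i| < 1} ∧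
        (∀ (y : EuclideanSpace ℝ (Fin 3)) (ρ : ℝ), 0 < ρ → closedBall y ρ ⊆ {x : EuclideanSpace ℝ (Fin 3) | ∀ i : Fin 3, |x i| < 1} →
          ∀ (W : EuclideanSpace ℝ (Fin 3) → EuclideanSpace ℝ (Fin 4)) (GW : EuclideanSpace ℝ (Fin 3) → (EuclideanSpace ℝ (Fin 3) →L[ℝ] EuclideanSpace ℝ (Fin 4))),
          HasWeakFDerivOn ⟨{x : EuclideanSpace ℝ (Fin 3) | ∀ i : Fin 3, |x i| < 1}, hQ⟩ volume W GW →
          (∀ x : EuclideanSpace ℝ (Fin 3), (∀ i : Fin 3, |x i| < 1) → ‖W x‖ = 1) →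
          IntegrableOn (fun x => ∑ i : Fin 3, ‖GW x (EuclideanSpace.single i (1:ℝ))‖ ^ 2) {x : EuclideanSpace ℝ (Fin 3) | ∀ i : Fin 3, |x i| < 1} →
          (∃ ρ' : ℝ, ρ' < ρ ∧ ∀ x : EuclideanSpace ℝ (Fin 3), x ∉ ball y ρ' → W x = (u j) x) →
          ∫ x in ball y ρ, ∑ i : Fin 3, ‖(Gs j) x (EuclideanSpace.single i (1:ℝ))‖ ^ 2 ≤ ∫ x in ball y ρ, ∑ i : Fin 3, ‖GW x (EuclideanSpace.single i (1:ℝ))‖ ^ 2)) :=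
    fun j => sMin_dilate hQ hS (ht0 j) (ht1 j)
  -- uniform energy bound `E(U_j; Q) ≤ Λ := 2√3·E(U; B_{1/2}) + 1`
  set Λ : ℝ := Real.sqrt 3 * ((1 / 2 : ℝ)⁻¹ * ∫ x in ball (0 : EuclideanSpace ℝ (Fin 3)) (1 / 2), ∑ i : Fin 3, ‖G x (EuclideanSpace.single i (1:ℝ))‖ ^ 2) + 1 with hΛ_def
  have h3 : (0 : ℝ) < Real.sqrt 3 := Real.sqrt_pos.mpr (by norm_num)
  have h3lt : Real.sqrt 3 < 2 := by
    have h := Real.sq_sqrt (show (0:ℝ) ≤ 3 by norm_num); nlinarith [Real.sqrt_nonneg 3]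
  have hEj : ∀ j : ℕ, ∫ x in {x : EuclideanSpace ℝ (Fin 3) | ∀ i : Fin 3, |x i| < 1}, ∑ i : Fin 3, ‖(Gs j) x (EuclideanSpace.single i (1:ℝ))‖ ^ 2 ≤ Λ := by
    intro j
    have h1 : ∫ x in {x : EuclideanSpace ℝ (Fin 3) | ∀ i : Fin 3, |x i| < 1}, ∑ i : Fin 3, ‖(Gs j) x (EuclideanSpace.single i (1:ℝ))‖ ^ 2 = (t j)⁻¹ * ∫ x in {x : EuclideanSpace ℝ (Fin 3) | ∀ i : Fin 3, |x i| < t j}, ∑ i : Fin 3, ‖G x (EuclideanSpace.single i (1:ℝ))‖ ^ 2 :=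
      setIntegral_dens_dilate_unitCube (ht0 j) G
    have hsub : {x : EuclideanSpace ℝ (Fin 3) | ∀ i : Fin 3, |x i| < t j} ⊆ ball (0 : EuclideanSpace ℝ (Fin 3)) (Real.sqrt 3 * t j) := absCube_subset_ball (ht0 j)
    have hσ : Real.sqrt 3 * t j ≤ 1 / 2 := by nlinarith [ht4 j, ht0 j]
    have hballQ : ball (0 : EuclideanSpace ℝ (Fin 3)) (Real.sqrt 3 * t j) ⊆ {x : EuclideanSpace ℝ (Fin 3) | ∀ i : Fin 3, |x i| < 1} := ball_subset_closedBall.trans (hcB _ (by linarith))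
    have h2 : ∫ x in {x : EuclideanSpace ℝ (Fin 3) | ∀ i : Fin 3, |x i| < t j}, ∑ i : Fin 3, ‖G x (EuclideanSpace.single i (1:ℝ))‖ ^ 2 ≤ ∫ x in ball (0 : EuclideanSpace ℝ (Fin 3)) (Real.sqrt 3 * t j), ∑ i : Fin 3, ‖G x (EuclideanSpace.single i (1:ℝ))‖ ^ 2 :=
      setIntegral_mono_set (hGi.mono_set hballQ) (Eventually.of_forall fun x => hdens0 G x) (Eventually.of_forall hsub)
    have hm := hmono (Real.sqrt 3 * t j) (1 / 2) (by positivity) hσ le_rfl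
    have hpos : 0 < Real.sqrt 3 * t j := by positivity
    rw [h1]
    calc (t j)⁻¹ * ∫ x in {x : EuclideanSpace ℝ (Fin 3) | ∀ i : Fin 3, |x i| < t j}, ∑ i : Fin 3, ‖G x (EuclideanSpace.single i (1:ℝ))‖ ^ 2
        ≤ (t j)⁻¹ * ∫ x in ball (0 : EuclideanSpace ℝ (Fin 3)) (Real.sqrt 3 * t j), ∑ i : Fin 3, ‖G x (EuclideanSpace.single i (1:ℝ))‖ ^ 2 := mul_le_mul_of_nonneg_left h2 (inv_nonneg.2 (ht0 j).le)
      _ = Real.sqrt 3 * ((Real.sqrt 3 * t j)⁻¹ * ∫ x in ball (0 : EuclideanSpace ℝ (Fin 3)) (Real.sqrt 3 * t j), ∑ i : Fin 3, ‖G x (EuclideanSpace.single i (1:ℝ))‖ ^ 2) := by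
          have htj : t j ≠ 0 := (ht0 j).ne'
          have h3' : Real.sqrt 3 ≠ 0 := h3.ne'
          field_simp
      _ ≤ Real.sqrt 3 * ((1 / 2 : ℝ)⁻¹ * ∫ x in ball (0 : EuclideanSpace ℝ (Fin 3)) (1 / 2), ∑ i : Fin 3, ‖G x (EuclideanSpace.single i (1:ℝ))‖ ^ 2) := mul_le_mul_of_nonneg_left hm h3.le
      _ ≤ Λ := by rw [hΛ_def]; linarith
  -- (C): a class member `φ` with convergent ball energies along `ψ`
  obtain ⟨φ, Gφ, ψ, hψ, hSφ, -, hEn⟩ := hCpt hQ Λ u Gs hSMin hEj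
  obtain ⟨hφ, hφ1, hGφi, hφmin⟩ := hSφ
  -- ball energies of `U_j`
  have hEuj : ∀ (j : ℕ) (r : ℝ), ∫ x in ball (0 : EuclideanSpace ℝ (Fin 3)) r, ∑ i : Fin 3, ‖(Gs j) x (EuclideanSpace.single i (1:ℝ))‖ ^ 2 = (t j)⁻¹ * ∫ x in ball (0 : EuclideanSpace ℝ (Fin 3)) (t j * r), ∑ i : Fin 3, ‖G x (EuclideanSpace.single i (1:ℝ))‖ ^ 2 := by
    intro j r
    have := setIntegral_dens_dilate_ball (ht0 j) G 0 r
    rwa [smul_zero] at this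
  -- `E(φ; B_r(0)) = Θ·r` for `0 < r ≤ 1/2`
  have hElin : ∀ r : ℝ, 0 < r → r ≤ 1 / 2 → ∫ x in ball (0 : EuclideanSpace ℝ (Fin 3)) r, ∑ i : Fin 3, ‖Gφ x (EuclideanSpace.single i (1:ℝ))‖ ^ 2 = Θ * r := by
    intro r hr hr2
    have hconv := hEn 0 r hr (hcB r (by linarith))
    have hconv' : Tendsto (fun j : ℕ => ∫ x in ball (0 : EuclideanSpace ℝ (Fin 3)) r, ∑ i : Fin 3, ‖(Gs (ψ j)) x (EuclideanSpace.single i (1:ℝ))‖ ^ 2) atTop (𝓝 (Θ * r)) := by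
      rw [Metric.tendsto_atTop]
      intro ε hε
      obtain ⟨r₀, hr₀, hr₀2, hlt⟩ := hΘapprox (ε / (2 * r)) (by positivity)
      obtain ⟨N, hN⟩ := (Metric.tendsto_atTop.1 htlim) (r₀ / r) (by positivity)
      refine ⟨N, fun j hj => ?_⟩
      have hψj : N ≤ ψ j := hj.trans (hψ.id_le j)
      have htj : t (ψ j) < r₀ / r := by
        have := hN (ψ j) hψj; rw [Real.dist_eq, sub_zero, abs_of_pos (ht0 _)] at this; exact this
      have hs0 : 0 < t (ψ j) * r := mul_pos (ht0 _) hr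
      have hsr₀ : t (ψ j) * r ≤ r₀ := by rw [lt_div_iff₀ hr] at htj; exact htj.le
      have hup := hlt (t (ψ j) * r) hs0 hsr₀
      have hlow := hΘle (t (ψ j) * r) hs0 (hsr₀.trans hr₀2)
      rw [hEuj, Real.dist_eq]
      set I : ℝ := ∫ x in ball (0 : EuclideanSpace ℝ (Fin 3)) (t (ψ j) * r), ∑ i : Fin 3, ‖G x (EuclideanSpace.single i (1:ℝ))‖ ^ 2 with hI_def
      set s : ℝ := t (ψ j) with hs_def
      have hsne : s ≠ 0 := (ht0 (ψ j)).ne'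
      have hrne : r ≠ 0 := hr.ne'
      have hid : s⁻¹ * I - Θ * r = r * ((s * r)⁻¹ * I - Θ) := by
        field_simp
      rw [hid, abs_mul, abs_of_pos hr]
      have hb : |(s * r)⁻¹ * I - Θ| < ε / (2 * r) := by
        rw [abs_lt]; constructor <;> linarith
      calc r * |(s * r)⁻¹ * I - Θ| < r * (ε / (2 * r)) := mul_lt_mul_of_pos_left hb hr
        _ = ε / 2 := by field_simp
        _ < ε := by linarith
    exact tendsto_nhds_unique hconv hconv'
  -- TM-C2: the radial derivative of `φ` vanishes a.e. on `B_{1/4}(0)`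
  have hB2 : ball (0 : EuclideanSpace ℝ (Fin 3)) (1 / 2) ⊆ {x : EuclideanSpace ℝ (Fin 3) | ∀ i : Fin 3, |x i| < 1} := ball_subset_closedBall.trans (hcB _ (by norm_num))
  have hrad := radialDeriv_ae_zero_of_ball_linear (Ω := ⟨{x : EuclideanSpace ℝ (Fin 3) | ∀ i : Fin 3, |x i| < 1}, hQ⟩) hφ (fun x hx => hφ1 x hx) hGφi (y := 0) (R := 1 / 2)
    (by norm_num) hB2 (fun W GW hW hW1 hWi hWU => hφmin 0 (1 / 2) (by norm_num) (hcB _ (by norm_num)) W GW hW (fun x hx => hW1 x hx) hWi hWU)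
    (Θ := Θ) (fun r hr hr2 => hElin r hr hr2)
  -- one more dilation: `φ_{1/8}` is a class member, radially constant a.e. on `Q`
  have h8 : (0:ℝ) < 1 / 8 := by norm_num
  have hS8 := sMin_dilate hQ ⟨hφ, hφ1, hGφi, hφmin⟩ h8 (by norm_num)
  have hta : ∀ x : EuclideanSpace ℝ (Fin 3), (∀ i : Fin 3, |x i| < 1) → (1 / 8 : ℝ) • x ∈ ball (0 : EuclideanSpace ℝ (Fin 3)) (1 / 2 / 2) := by
    intro x hx
    have h1 : (1 / 8 : ℝ) • x ∈ {z : EuclideanSpace ℝ (Fin 3) | ∀ i : Fin 3, |z i| < 1 / 8} := by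
      intro i; rw [PiLp.smul_apply, smul_eq_mul, abs_mul, abs_of_pos h8]
      calc 1 / 8 * |x i| < 1 / 8 * 1 := mul_lt_mul_of_pos_left (hx i) h8
        _ = 1 / 8 := by ring
    have h2 := absCube_subset_ball h8 h1
    exact ball_subset_ball (by nlinarith [h3lt]) h2
  have hrad8 : ∀ᵐ x ∂(volume.restrict {x : EuclideanSpace ℝ (Fin 3) | ∀ i : Fin 3, |x i| < 1}),
      (((1 / 8 : ℝ) • Gφ ((1 / 8 : ℝ) • x)) : EuclideanSpace ℝ (Fin 3) →L[ℝ] EuclideanSpace ℝ (Fin 4)) x = 0 := by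
    have h := ae_restrict_unitCube_of_ae_restrict_ball (P := fun z : EuclideanSpace ℝ (Fin 3) =>
      (∑ i : Fin 3, (z i - (0 : EuclideanSpace ℝ (Fin 3)) i) • Gφ z (EuclideanSpace.single i (1:ℝ))) = 0) h8 hta hrad
    filter_upwards [h] with x hx
    have hx' : ∑ i : Fin 3, ((1 / 8 : ℝ) • x) i • Gφ ((1 / 8 : ℝ) • x) (EuclideanSpace.single i (1:ℝ)) = 0 := by
      simpa only [PiLp.zero_apply, sub_zero] using hx
    rw [sum_smul_apply_single] at hx'
    rw [FunLike.coe_smul, Pi.smul_apply, ← map_smul]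
    exact hx'
  -- (TM): `φ_{1/8}` has zero gradient a.e. on `Q`
  have hzero := hTM hQ (fun x => φ ((1 / 8 : ℝ) • x)) (fun x => (1 / 8 : ℝ) • Gφ ((1 / 8 : ℝ) • x)) hS8 hrad8
  -- hence `Θ/2 = E(φ_{1/8}; B_{1/2}(0)) = 0`
  have hE8 : ∫ x in ball (0 : EuclideanSpace ℝ (Fin 3)) (1 / 2), ∑ i : Fin 3, ‖((1 / 8 : ℝ) • Gφ ((1 / 8 : ℝ) • x)) (EuclideanSpace.single i (1:ℝ))‖ ^ 2 = 0 := by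
    refine integral_eq_zero_of_ae ?_
    filter_upwards [ae_restrict_of_ae_restrict_of_subset hB2 hzero] with x hx
    have hx' : (1 / 8 : ℝ) • Gφ ((1 / 8 : ℝ) • x) = 0 := hx
    show ∑ i : Fin 3, ‖((1 / 8 : ℝ) • Gφ ((1 / 8 : ℝ) • x)) (EuclideanSpace.single i (1:ℝ))‖ ^ 2 = 0
    rw [hx']
    simp
  have hE8' : ∫ x in ball (0 : EuclideanSpace ℝ (Fin 3)) (1 / 2), ∑ i : Fin 3, ‖((1 / 8 : ℝ) • Gφ ((1 / 8 : ℝ) • x)) (EuclideanSpace.single i (1:ℝ))‖ ^ 2 = Θ / 2 := by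
    have := setIntegral_dens_dilate_ball h8 Gφ 0 (1 / 2)
    rw [smul_zero] at this
    rw [this, hElin (1 / 8 * (1 / 2)) (by norm_num) (by norm_num)]
    ring
  have : Θ / 2 = 0 := by rw [← hE8', hE8]
  linarith

end Summit.QuantumFields.YangMills.Theorems.PoincareLipschitzZeroDensityOfTangentMaps

end
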